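import Mathlib.Analysis.Analytic.IsolatedZeros
import Mathlib.Analysis.Complex.Basic
import HarnessLib

/-!
# RH-FREE punchline of the corner gap (L2 of `ScrewManifestCornerGap`): no even entire function is `z/2` on `[1, 3]`

Step (iii) of sos-theory's route to `Manifest.CornerGap` (note SCREW-P3-FOLD-NOTE-g19 §2, L2): a limit atom
measure `μ` on `[0, θ]` would give `Φ_μ(z) = ∫ (1 − cos τz)/τ² dμ(τ)`, an ENTIRE and EVEN function equal to
`z/2` on `[1, 3]` — impossible.  This file records the impossibility in the form the compactness argument
consumes:

* `false_of_even_analytic_eq_half_on_Icc` : if `f : ℂ → ℂ` is analytic on `ℂ`, even, and `f s = s/2` for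
  real `s ∈ [1, 3]`, then `False` (identity principle at the accumulation point `2`, then `f(−1) = f(1)`).

RH-FREE complex analysis; nothing here bears on the truth of RH.  References: [folklore].
-/

set_option linter.dupNamespace false
set_option autoImplicit false

noncomputable section

open Set Filter Topology

namespace Summit.RiemannHypothesis.RiemannHypothesis.Theorems.IntegerScrew.Manifest

/-- **No even entire function equals `z/2` on `[1, 3]`.** [folklore] -/
theorem false_of_even_analytic_eq_half_on_Icc {f : ℂ → ℂ} (hf : AnalyticOnNhd ℂ f univ)
    (heven : ∀ z : ℂ, f (-z) = f z) (hseg : ∀ s : ℝ, 1 ≤ s → s ≤ 3 → f s = s / 2) : False := by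
  set g : ℂ → ℂ := fun z => f z - z * (1 / 2) with hg
  have hga : AnalyticOnNhd ℂ g univ := hf.sub (analyticOnNhd_id.mul analyticOnNhd_const)
  have hcl : (2 : ℂ) ∈ closure ({z | g z = 0} \ {2}) := by
    rw [Metric.mem_closure_iff]
    intro ε hε
    set r : ℝ := min (ε / 2) (1 / 2) with hr
    have hr0 : 0 < r := lt_min (by linarith) (by norm_num)
    have hrε : r ≤ ε / 2 := min_le_left _ _
    have hr1 : r ≤ 1 / 2 := min_le_right _ _
    refine ⟨((2 + r : ℝ) : ℂ), ⟨?_, ?_⟩, ?_⟩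
    · show f ((2 + r : ℝ) : ℂ) - ((2 + r : ℝ) : ℂ) * (1 / 2) = 0
      rw [hseg (2 + r) (by linarith) (by linarith)]
      ring
    · intro h
      have h' : ((2 + r : ℝ) : ℂ) = (2 : ℂ) := h
      have := congrArg Complex.re h'
      simp at this
      linarith
    · rw [Complex.dist_eq]
      have e : (2 : ℂ) - ((2 + r : ℝ) : ℂ) = ((-r : ℝ) : ℂ) := by push_cast; ring
      rw [e, Complex.norm_real, Real.norm_eq_abs, abs_neg, abs_of_pos hr0]
      linarith
  have hzero : EqOn g 0 univ :=
    hga.eqOn_zero_of_preconnected_of_mem_closure isPreconnected_univ (mem_univ _) hcl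
  have h1 : g ((-1 : ℝ) : ℂ) = 0 := hzero (mem_univ _)
  have h2 : f ((-1 : ℝ) : ℂ) = f ((1 : ℝ) : ℂ) := by
    have := heven ((1 : ℝ) : ℂ)
    push_cast at this ⊢
    exact this
  have h3 : f ((1 : ℝ) : ℂ) = ((1 : ℝ) : ℂ) / 2 := hseg 1 le_rfl (by norm_num)
  have h4 : f ((-1 : ℝ) : ℂ) - ((-1 : ℝ) : ℂ) * (1 / 2) = 0 := h1
  rw [h2, h3] at h4
  push_cast at h4
  norm_num at h4

/-- **Ball version** (the form produced by a locally uniform limit on a disc): if `f` is analytic on the open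
ball `ball 0 R` with `R > 3`, even on it, and `f s = s/2` for real `s ∈ [1, 3]`, then `False`. [folklore] -/
theorem false_of_even_analyticOnNhd_ball_eq_half_on_Icc {f : ℂ → ℂ} {R : ℝ} (hR : 3 < R)
    (hf : AnalyticOnNhd ℂ f (Metric.ball 0 R))
    (heven : ∀ z ∈ Metric.ball (0 : ℂ) R, f (-z) = f z)
    (hseg : ∀ s : ℝ, 1 ≤ s → s ≤ 3 → f s = s / 2) : False := by
  set g : ℂ → ℂ := fun z => f z - z * (1 / 2) with hg
  have hga : AnalyticOnNhd ℂ g (Metric.ball 0 R) :=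
    hf.sub ((analyticOnNhd_id.mul analyticOnNhd_const).mono (subset_univ _))
  have hmem : ∀ x : ℝ, |x| < R → ((x : ℝ) : ℂ) ∈ Metric.ball (0 : ℂ) R := by
    intro x hx
    rw [Metric.mem_ball, dist_zero_right, Complex.norm_real, Real.norm_eq_abs]
    exact hx
  have h2 : ((2 : ℝ) : ℂ) ∈ Metric.ball (0 : ℂ) R := hmem 2 (by rw [abs_of_pos (by norm_num)]; linarith)
  have hcl : ((2 : ℝ) : ℂ) ∈ closure ({z | g z = 0} \ {((2 : ℝ) : ℂ)}) := by
    rw [Metric.mem_closure_iff]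
    intro ε hε
    set r : ℝ := min (ε / 2) (1 / 2) with hr
    have hr0 : 0 < r := lt_min (by linarith) (by norm_num)
    have hrε : r ≤ ε / 2 := min_le_left _ _
    have hr1 : r ≤ 1 / 2 := min_le_right _ _
    refine ⟨((2 + r : ℝ) : ℂ), ⟨?_, ?_⟩, ?_⟩
    · show f ((2 + r : ℝ) : ℂ) - ((2 + r : ℝ) : ℂ) * (1 / 2) = 0
      rw [hseg (2 + r) (by linarith) (by linarith)]
      ring
    · intro h
      have h' : ((2 + r : ℝ) : ℂ) = ((2 : ℝ) : ℂ) := h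
      have := congrArg Complex.re h'
      simp at this
      linarith
    · rw [Complex.dist_eq]
      have e : ((2 : ℝ) : ℂ) - ((2 + r : ℝ) : ℂ) = ((-r : ℝ) : ℂ) := by push_cast; ring
      rw [e, Complex.norm_real, Real.norm_eq_abs, abs_neg, abs_of_pos hr0]
      linarith
  have hzero : EqOn g 0 (Metric.ball 0 R) :=
    hga.eqOn_zero_of_preconnected_of_mem_closure (convex_ball (0 : ℂ) R).isPreconnected h2 hcl
  have hm1 : ((-1 : ℝ) : ℂ) ∈ Metric.ball (0 : ℂ) R :=
    hmem (-1) (by rw [abs_neg, abs_one]; linarith)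
  have hp1 : ((1 : ℝ) : ℂ) ∈ Metric.ball (0 : ℂ) R := hmem 1 (by rw [abs_one]; linarith)
  have h1 : g ((-1 : ℝ) : ℂ) = 0 := hzero hm1
  have h2' : f ((-1 : ℝ) : ℂ) = f ((1 : ℝ) : ℂ) := by
    have := heven ((1 : ℝ) : ℂ) hp1
    push_cast at this ⊢
    exact this
  have h3 : f ((1 : ℝ) : ℂ) = ((1 : ℝ) : ℂ) / 2 := hseg 1 le_rfl (by norm_num)
  have h4 : f ((-1 : ℝ) : ℂ) - ((-1 : ℝ) : ℂ) * (1 / 2) = 0 := h1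
  rw [h2', h3] at h4
  push_cast at h4
  norm_num at h4

end Summit.RiemannHypothesis.RiemannHypothesis.Theorems.IntegerScrew.Manifest

end
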